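/-
Origin: expansion seat `planner-pub-hodgecm-mc-axioms-1-g14-0`, handover #W204 2026-08-20T15:53:55Z md5 37c4a87aa9da (PKG 77d8afa9316a → 37c4a87aa9da; 153 l.; MECHANICAL (iib-R) rewrite v3.1 of the PKG file as it stands (2 token edits; rules R1x1+RX[h₂]x1)) (`HOME/mc/pub-hodgecm-mc-axioms-1-g14/revendor/kit-r55/stage55/HodgeCM/Model/Binders/Real34WedgeKType.lean`, md5 37c4a87aa9da, 153 lines);
landed by the gen-22 packager (p-g22) in gate run 55 REPLACES the earlier landed copy of `HodgeCM/Model/Binders/Real34WedgeKType.lean` (seat copy carried the packager Origin header of an earlier run (stripped)).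
-/
/-
Origin: DISCHARGE seat `prover-pub-hodgecm-mc-discharge-1-g16-0` (unit pub-hodgecm-mc-discharge-1-g16, gen 16 of mc-discharge-1), ticket **D-6**
(BINDER-OWNERS row 15 `real34`, sub-item (K34) `gen_mem`), 2026-08-19.  NEW additive PKG leaf `HodgeCM/Model/Binders/Real34WedgeKType.lean` —
the (34) TWIN of binder-1's `Model/Binders/Gen12WedgeKType` (kit `t36-mcbinder1g7.txt` #12): the ONE-PAIR case of `Real34GenMem`'s hypothesis
`hdec` as a JUNCTION theorem, from hypotheses in the shapes the producers export for the (12) side ((x-S)₁ `op1`, (x-W) `hSK'`, (x-Θ) `hA`/`hB`,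
the character bookkeeping `hχ`) and the abstract wedge law of `Model/Binders/Real34KTypeWedge` (same ticket, row #7).  Imports binder-1's RUN-36
row #2 `Model/Binders/Gen12Junctions` (for `pinX`) and row #7; no `Level` tokens (world-independent source).  KERNEL ONLY: 0 records, 0
`def … : Prop`, 0 proof holes, nothing cited, MODEL-N ±0, E text untouched.  Expected `#print axioms`: {propext, Classical.choice, Quot.sound}.
-/
import Summits.HodgeConjecture.HodgeCM.Model.Binders.Gen12Junctions_2
import Summits.HodgeConjecture.HodgeCM.Model.Binders.Real34KTypeWedge

/-!
# (K34) at the pin, one pair of `K`-types: a test function of `𝒮^κ` in the span of `τ(frame₂ ⊗ frame₃)` is a wedge tensor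

For ADMISSIBLE `K`-type situations `Sit₂`, `Sit₃` of lines `2`, `3` with test families `j₂`, `j₃`, consider the four pure tensors
`τ (j₂ (ι₂ e_a)) (j₃ (ι₃ e_b))` of their `𝔭₊`-frame vectors in the W-block's Schwartz–Bruhat space.  **`wedgeTensor_of_kType`**: if a
combination `Σ M a b • τ (j₂ (ι₂ e_a)) (j₃ (ι₃ e_b))` lies in `𝒮^κ = (W V c).SK`, it is the multiple `((M 0 1 − M 1 0)/2)` of the WEDGE TENSOR
`τ (j₂ (ι₂ e₀)) (j₃ (ι₃ e₁)) − τ (j₂ (ι₂ e₁)) (j₃ (ι₃ e₀))` — PerL Lemma 3.5 (34), tex ll. 367–372, for one pair of `𝔭₊`-types.  Hypotheses,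
each in its producer's currency (compare `Gen12WedgeKType.wedgeMem_of_kType`):

* (x-S)₁ `op1` — along a compact family `gK : Kι → G_U(𝔸)` (the archimedean isotropy of the base point), `W.ρ(eV (gK k), 1)` restricts on
  the bilinear `τ` to the two line actions `P₂.ω(gK k, 1)`, `P₃.ω(gK k, 1)` (period-1, the `t = 1` case of the (34) operator-level see-saw);
* (x-W) `hSK'` — `𝒮^κ` lies in the `χ`-eigenspace of the family (unitary-1: `mem_cmKTypeTwist_iff`; the converse inclusion is #12's `hSK`);
* (x-Θ) `hA`, `hB` — the frame vectors of admissible situations of line `2` (resp. `3`) transform under `P₂.ω(gK k, 1)` (resp. `P₃.ω`) through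
  ONE continuous matrix representation `m : Kι →* GL₂`-valued (`𝔭₊`), up to line characters `c₂ k`, `c₃ k` (theta-3: (E4)/(E2) of the
  (Θ-sat) packet; the characters carry the lines' vacuum / `U(1)`-parts);
* `hχ` — `χ k = c₂ k · c₃ k · det (m k)` (the (34) determinant bookkeeping, unitary-1 W2-Kn / (c5));
* `h₁`, `h₂` — the image of `m` contains a diagonal matrix with distinct entries and an anti-diagonal one (a weight basis of `𝔭₊` and a
  Weyl representative in `K_∞ ⊇ U(1) × U(1)`).

The general `hdec` of `Real34GenMem.Real34Loc.gen_mem_of_kType` is this statement summed over the finitely many pairs of `K`-types met by a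
`K`-finite test function, the pairs of `k₀`-weights `≠ (1,1)` being killed by `KTypeWedge.eq_zero_of_weights`.  Nothing here is a claim of the
manuscripts under adjudication.
-/

set_option autoImplicit false

noncomputable section

open MeasureTheory NumberField
open HodgeCM.PerL34.Qaut (T)

namespace HodgeCM.Model

open HodgeCM HodgeCM.Universe
open Literature.NumberTheory.Weil1964
open Literature.NumberTheory.Automorphic (piSchwartzBruhat)
open Literature.AlgebraicGeometry.HodgeTheory
open Literature.NumberTheory.Automorphic.PicardCM
open Literature.NumberTheory.Transcendental (Arapura2012_Cor_15_4_6)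
open HodgeCM.Model.ThetaSpace HodgeCM.Model.KTypeWedge

variable (hHD : exists_isReal_hodgeModel) (hI : hodgePQ_independent_of_hodgeModel)
  (h₁ : BallQuotientUniformised)  (h₃ : CMAbelianVarietyRealised)
variable (W : ∀ {L : CMField} {ι₁ : L →+* ℂ} (V : HermSpace3 L ι₁) (c : SeesawCtx L), WmInput V c.D)
  (S : ∀ {L : CMField} {ι₁ : L →+* ℂ} (V : HermSpace3 L ι₁) (c : SeesawCtx L), ThetaAdelicSide V c)
variable {L : CMField} {ι₁ : L →+* ℂ} (V : HermSpace3 L ι₁) (c : SeesawCtx L) (hV : IsAnisotropic L V.Hm)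

local notation3 "L⁺" => maximalRealSubfield (L : Type)
local notation3 "𝕏" => pinX hHD hI h₁ h₃ S V c hV

/-- **The frame span transforms through `ρ ⊗ ρ` up to the product of the line characters** — the hypothesis `hS` of
`KTypeWedge.biS_eq_smul_wedge_of_detType` for the W-block's `τ`, from (x-S)₁ `op1` and the frame laws of the two lines. -/
theorem biS_frame_transform {Kι : Type*} (gK : Kι → ↥(Adelic.regimeSubgroup L V.Hm))
    (τ : piSchwartzBruhat L⁺ (Fin 3) →ₗ[ℂ] piSchwartzBruhat L⁺ (Fin 3) →ₗ[ℂ] piSchwartzBruhat (W V c).F (W V c).ι)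
    (op1 : ∀ (k : Kι) (φ₂ φ₃ : piSchwartzBruhat L⁺ (Fin 3)),
      (((W V c).ρ ((W V c).eV (gK k : ↥(Adelic.adelicUnitaryGroup L V.Hm)), 1)) :
          Module.End ℂ (piSchwartzBruhat (W V c).F (W V c).ι)) (τ φ₂ φ₃) =
        τ (((S V c).P 2).ω (gK k, 1) φ₂) (((S V c).P 3).ω (gK k, 1) φ₃))
    (m : Kι → Matrix (Fin 2) (Fin 2) ℂ) (c₂ c₃ : Kι → ℂ)
    (e f : Fin 2 → piSchwartzBruhat L⁺ (Fin 3))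
    (he : ∀ (k : Kι) (i : Fin 2), ((S V c).P 2).ω (gK k, 1) (e i) = c₂ k • ∑ l, m k l i • e l)
    (hf : ∀ (k : Kι) (i : Fin 2), ((S V c).P 3).ω (gK k, 1) (f i) = c₃ k • ∑ l, m k l i • f l)
    (k : Kι) (w : Fin 2 → Fin 2 → ℂ) :
    (((W V c).ρ ((W V c).eV (gK k : ↥(Adelic.adelicUnitaryGroup L V.Hm)), 1)) :
        Module.End ℂ (piSchwartzBruhat (W V c).F (W V c).ι)) (biS τ e f w) =
      (c₂ k * c₃ k) • biS τ e f (T (m k) w) := by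
  set R := (((W V c).ρ ((W V c).eV (gK k : ↥(Adelic.adelicUnitaryGroup L V.Hm)), 1)) :
      Module.End ℂ (piSchwartzBruhat (W V c).F (W V c).ι)) with hR
  have hReq : ∀ a b, R (τ (e a) (f b)) = ∑ l, ∑ l', ((c₂ k * c₃ k) * (m k l a * m k l' b)) • τ (e l) (f l') := by
    intro a b
    rw [hR, op1, he, hf]
    simp only [map_smul, LinearMap.smul_apply, map_sum, LinearMap.sum_apply, Finset.smul_sum, smul_smul]
    rw [Finset.sum_comm]
    refine Finset.sum_congr rfl fun l _ => Finset.sum_congr rfl fun l' _ => ?_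
    congr 1
    ring
  rw [biS_apply, biS_apply, map_sum]
  simp_rw [map_sum, map_smul, hReq]
  simp only [HodgeCM.PerL34.Qaut.T_apply, Fin.sum_univ_two, smul_add, smul_smul, add_smul]
  module

/-- **(K34), ONE PAIR OF `K`-TYPES, at the pin** (the (34) twin of `Gen12WedgeKType.wedgeMem_of_kType`): a combination of the four pure tensors
`τ (j₂ (ι₂ e_a)) (j₃ (ι₃ e_b))` of the `𝔭₊`-frames of two ADMISSIBLE situations of lines `2`, `3` that lies in `𝒮^κ` is
`((M 0 1 − M 1 0)/2) •` their wedge tensor. -/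
theorem wedgeTensor_of_kType
    (adm : ∀ (Γ : Level V) (k : Fin 4), KTypeSituation ((𝕏).P k) ((𝕏).ιinf Γ) ((𝕏).Δ Γ) (𝕏).κ₁ (𝕏).τ₁ → Prop)
    {Kι : Type*} [Group Kι] [TopologicalSpace Kι] [IsTopologicalGroup Kι] [MeasurableSpace Kι] [BorelSpace Kι]
    [CompactSpace Kι] (μK : Measure Kι) [IsProbabilityMeasure μK] [μK.IsMulLeftInvariant]
    (gK : Kι → ↥(Adelic.regimeSubgroup L V.Hm)) (χ c₂ c₃ : Kι → ℂ)
    (τ : piSchwartzBruhat L⁺ (Fin 3) →ₗ[ℂ] piSchwartzBruhat L⁺ (Fin 3) →ₗ[ℂ] piSchwartzBruhat (W V c).F (W V c).ι)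
    (op1 : ∀ (k : Kι) (φ₂ φ₃ : piSchwartzBruhat L⁺ (Fin 3)),
      (((W V c).ρ ((W V c).eV (gK k : ↥(Adelic.adelicUnitaryGroup L V.Hm)), 1)) :
          Module.End ℂ (piSchwartzBruhat (W V c).F (W V c).ι)) (τ φ₂ φ₃) =
        τ (((S V c).P 2).ω (gK k, 1) φ₂) (((S V c).P 3).ω (gK k, 1) φ₃))
    (hSK' : ∀ Ψ ∈ (W V c).SK, ∀ k : Kι,
      (((W V c).ρ ((W V c).eV (gK k : ↥(Adelic.adelicUnitaryGroup L V.Hm)), 1)) :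
          Module.End ℂ (piSchwartzBruhat (W V c).F (W V c).ι)) Ψ = χ k • Ψ)
    (m : Kι →* Matrix (Fin 2) (Fin 2) ℂ) (hmc : Continuous fun k => m k) (hmu : ∀ k, IsUnit (m k).det)
    (hm₁ : ∃ k s t, s ≠ t ∧ m k = !![s, 0; 0, t]) (hm₂ : ∃ k a b, m k = !![0, a; b, 0])
    (hχ : ∀ k, χ k = c₂ k * c₃ k * (m k).det) (hc : ∀ k, c₂ k * c₃ k ≠ 0)
    (hA : ∀ (Γ : Level V) (Sit : KTypeSituation ((𝕏).P 2) ((𝕏).ιinf Γ) ((𝕏).Δ Γ) (𝕏).κ₁ (𝕏).τ₁),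
      adm Γ 2 Sit → ∀ j ∈ Sit.𝓙, ∀ (k : Kι) (i : Fin 2),
        ((S V c).P 2).ω (gK k, 1) (j.1 (Sit.ι (LinearMap.proj i))) = c₂ k • ∑ l, m k l i • j.1 (Sit.ι (LinearMap.proj l)))
    (hB : ∀ (Γ : Level V) (Sit : KTypeSituation ((𝕏).P 3) ((𝕏).ιinf Γ) ((𝕏).Δ Γ) (𝕏).κ₁ (𝕏).τ₁),
      adm Γ 3 Sit → ∀ j ∈ Sit.𝓙, ∀ (k : Kι) (i : Fin 2),
        ((S V c).P 3).ω (gK k, 1) (j.1 (Sit.ι (LinearMap.proj i))) = c₃ k • ∑ l, m k l i • j.1 (Sit.ι (LinearMap.proj l))) :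
    ∀ (Γ₂ Γ₃ : Level V)
      (Sit₂ : KTypeSituation ((𝕏).P 2) ((𝕏).ιinf Γ₂) ((𝕏).Δ Γ₂) (𝕏).κ₁ (𝕏).τ₁)
      (Sit₃ : KTypeSituation ((𝕏).P 3) ((𝕏).ιinf Γ₃) ((𝕏).Δ Γ₃) (𝕏).κ₁ (𝕏).τ₁),
      adm Γ₂ 2 Sit₂ → adm Γ₃ 3 Sit₃ → ∀ j₂ ∈ Sit₂.𝓙, ∀ j₃ ∈ Sit₃.𝓙, ∀ M : Fin 2 → Fin 2 → ℂ,
        biS τ (fun a => j₂.1 (Sit₂.ι (LinearMap.proj a))) (fun b => j₃.1 (Sit₃.ι (LinearMap.proj b))) M ∈ (W V c).SK →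
        biS τ (fun a => j₂.1 (Sit₂.ι (LinearMap.proj a))) (fun b => j₃.1 (Sit₃.ι (LinearMap.proj b))) M =
          ((M 0 1 - M 1 0) / 2) •
            (τ (j₂.1 (Sit₂.ι (LinearMap.proj 0))) (j₃.1 (Sit₃.ι (LinearMap.proj 1))) -
              τ (j₂.1 (Sit₂.ι (LinearMap.proj 1))) (j₃.1 (Sit₃.ι (LinearMap.proj 0)))) := by
  intro Γ₂ Γ₃ Sit₂ Sit₃ had₂ had₃ j₂ hj₂ j₃ hj₃ M hM
  have hS : ∀ (k : Kι) (w : Fin 2 → Fin 2 → ℂ),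
      (((W V c).ρ ((W V c).eV (gK k : ↥(Adelic.adelicUnitaryGroup L V.Hm)), 1)) :
          Module.End ℂ (piSchwartzBruhat (W V c).F (W V c).ι))
        (biS τ (fun a => j₂.1 (Sit₂.ι (LinearMap.proj a))) (fun b => j₃.1 (Sit₃.ι (LinearMap.proj b))) w) =
      (c₂ k * c₃ k) • biS τ (fun a => j₂.1 (Sit₂.ι (LinearMap.proj a))) (fun b => j₃.1 (Sit₃.ι (LinearMap.proj b))) (T (m k) w) :=
    fun k w => biS_frame_transform W S V c gK τ op1 (fun k => m k) c₂ c₃ _ _ (hA Γ₂ Sit₂ had₂ j₂ hj₂) (hB Γ₃ Sit₃ had₃ j₃ hj₃) k w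
  have hv : ∀ k : Kι,
      (((W V c).ρ ((W V c).eV (gK k : ↥(Adelic.adelicUnitaryGroup L V.Hm)), 1)) :
          Module.End ℂ (piSchwartzBruhat (W V c).F (W V c).ι))
        (biS τ (fun a => j₂.1 (Sit₂.ι (LinearMap.proj a))) (fun b => j₃.1 (Sit₃.ι (LinearMap.proj b))) M) =
      (c₂ k * c₃ k * (m k).det) • biS τ (fun a => j₂.1 (Sit₂.ι (LinearMap.proj a))) (fun b => j₃.1 (Sit₃.ι (LinearMap.proj b))) M := by
    intro k
    rw [hSK' _ hM k, hχ]
  exact biS_eq_smul_wedge_of_detType μK hmc hmu hm₁ hm₂ τ _ _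
    (fun k => (((W V c).ρ ((W V c).eV (gK k : ↥(Adelic.adelicUnitaryGroup L V.Hm)), 1)) :
      Module.End ℂ (piSchwartzBruhat (W V c).F (W V c).ι)))
    (fun k => c₂ k * c₃ k) hc hS M hv

end HodgeCM.Model

end
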